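import Summits.QuantumFields.YangMills.Theorems.BalabanUVNodesN15CovariantLandauNodeFourCovariant
import Summits.QuantumFields.YangMills.Theorems.BalabanUVNodesN15TwoSpacingGluingCurvedKnitCovariantLandauGlobalRowsFromGradDiff
import HarnessLib
/-!
# N15 = NE2 — dag-n15-a g33, PROGRAMME (P-R)₄ «ALL FOUR ENTRIES OF (3.42) FOR THE (P-R) FAMILY», (R8a): THE (P-R) ENTRY ASSIGNMENT `sfqrE₄` AND ★★★ `NE2PlusOperator` WITH ALL FOUR ENTRIES
# CONCRETE — Bałaban's WHOLE covariant summand `a·Q*(U)Q(U) − D_U(I − R(U))D*_U` live in the propagator, entries 1–3 PINNED to (R6)'s covariant forward-gradient defects and (R5)'s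
# `(ΔG)`-defect — modulo ONLY the Landau letter's thresholded global rows (207b's `hG`), resp. n15-c∕223's display (one gradient-difference row per grid + the two-grid defect row)
# (dag-n15-a g33, (R8a); node N15 = NE2; `--supports stmt-QuantumFields-27366 --as helper`, count-neutral; 1 plumbing def + 2 theorems; imports (R7b), (♭-6))

WHY.  The located gap `hE` of the lane's most print-faithful literal (F6 ∕ (♭-3) ∕ (♭-7) `sfObjects₇qvr`: entries 1–3 of `sfqrFamily … (E ·)` displayed in 207∕207b∕211∕219∕223) is closed by
PROGRAMME (P-R)₄: (R1)(R2) caps, (R3) one-grid jets, (R4) jet defects, (R5) the `(ΔG)`-defect, (R6) the covariant forward-gradient defect, (R7a)(R7b) the node with the entries pinned by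
EQUATIONS.  THIS FILE makes the assignment CONCRETE — the (P-R) twin of (Q-7) `sfqE₄` ∕ `ne2PlusOperator_sfq₄E` and of Σ-F `sfE₄cov`: `sfqrE₄` lists the four right-hand sides, and (R7b) is
fed with it by `rfl` ×3.  With (♭-6) the display reduces to n15-c∕223's.

WHAT.  def `sfqrE₄ hL a μ₁ μ₂ i : Fin 4 → …` (slot 0 `sfqrEntry0`, slots 1–2 the covariant forward-gradient defects at `μ₁, μ₂`, slot 3 the `(ΔG)`-defect); ★★★ `ne2PlusOperator_sfqr₄E … μ₁ μ₂
(hG)`; ★★★ `ne2PlusOperator_sfqr₄E_of_gradDiffRow … μ₁ μ₂ (hP) (hD)`.  Sequel (R8b): the all-layers literal `sfObjects₈qvr` with `E := sfqrE₄` — `hE` DROPPED.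

HONEST FRAMING ∕ LIMITS.  MODEL family on MODEL carriers (doubled-torus cover `2L^{m+1}`, `L ≥ 7`; global small-field gauge `U = e^{ηĀ′}`, `U′ = e^{η′A′}`; `Q(U)` = the main term (125) of [B7]
(124), not the full nonlinear average; covariant forward gradients in FILE 144's model sense; entrywise (3.42) SHAPES with crude constants); the Landau rows (resp. the gradient-difference
rows and the two-grid defect row) are HYPOTHESES; NOT [Balaban1985BackgroundPropagators] Thm 3.1 ∕ 3.4 ∕ 3.14 as printed and no estimate of Bałaban's; NE2⁺ NOT PRINTED.  N15 of record
untouched (DISCHARGED AS CONSUMED, p687738) — no re-pin, no count moved; K3⁸ OPEN; one finite 𝕋⁴ at fixed ε per index — NOT infinite volume ∕ OS ∕ mass gap ∕ Clay.  Plumbing `def` ⇒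
review ∕ audit lane.  `set_option maxRecDepth 8192 in` ×2 + `maxHeartbeats 1600000` ×1 (the `rfl`s through 207a's ∕ (R5)(R6)'s large terms — Σ-F's lesson (e)).  Restate-immune (no Theses import).
-/

noncomputable section

open scoped BigOperators Matrix

namespace Summit.QuantumFields.YangMills.BalabanUVNodes.N15.Gluing

open Literature.MathematicalPhysics.QuantumFieldTheory.Balaban1983to89
open Literature.MathematicalPhysics.QuantumFieldTheory.Balaban1983to89.B11SectG (BlockNorm HasMaj)
open Literature.MathematicalPhysics.QuantumFieldTheory.Balaban1983to89.B6UnitTorusCarrier (unitTorusGeo)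
open Literature.MathematicalPhysics.QuantumFieldTheory.Balaban1983to89.T4EtaRate (NE2PlusOperator EtaRateIneq342 rateFactor rateFactor_nonneg)
open Literature.MathematicalPhysics.QuantumFieldTheory.Balaban1983to89.T4EtaRateDefect (idef)
open Literature.MathematicalPhysics.QuantumFieldTheory.Balaban1983to89.T4EtaRateCoeffDefect (pull)
open Summit.QuantumFields.YangMills.BalabanUVNodes.N15.BackgroundLayer (covLapM gavgM fgrad bgrad)
open Summit.QuantumFields.YangMills.BalabanUVNodes.N15.MatrixSpecies (coordMat liftMap liftEquiv covD)
open Summit.QuantumFields.YangMills.BalabanUVNodes.N15.CurvedSpecies (gaugePair)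
open Literature.Barriers.QuantumFields (traceForm)
open Summit.QuantumFields.YangMills.BalabanUVNodes.N15.VectorPiece (bshiftEquiv kingPrV unitTorusGeoS)
open Summit.QuantumFields.YangMills.BalabanUVNodes.N15.MatrixSpecies (liftBlk basisConst basisConst_nonneg)
open Summit.QuantumFields.YangMills.BalabanUVNodes.N15.OperatorReadout (opGeo)
open Summit.QuantumFields.YangMills.BalabanUVNodes.N15.CovLandau (cgrad cGreen)
open Literature.MathematicalPhysics.QuantumFieldTheory.King1986 (aK)
open Literature.MathematicalPhysics.QuantumFieldTheory.King1986.Torus (blockOf)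
open Literature.MathematicalPhysics.QuantumFieldTheory.Balaban1983to89.B5Prop11Plancherel (Tor fine)
open Literature.NumberTheory.Sieve.SquarefreeSums (exp_sub_one_le_two_mul)

variable {d : ℕ} {L : ℕ} [NeZero L]

/-! ## The (P-R) entry assignment made concrete; `NE2PlusOperator` with all four entries concrete, modulo the Landau rows -/

section Node

open scoped Matrix.Norms.L2Operator

variable (d) (mm ι : Type) [Fintype mm] [DecidableEq mm] [Nonempty mm] [Fintype ι] [DecidableEq ι] (e : Matrix mm mm ℂ ≃L[ℝ] (ι → ℝ))

/-- **THE (P-R) ENTRY ASSIGNMENT MADE CONCRETE** (`Σ-R`, the (P-R) twin of (Q-7)'s `sfqE₄` ∕ Σ-F's `sfE₄cov`): slot 0 = n15-c∕207a `sfqrEntry0` (the η-defect of the glued propagators with Bałaban's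
WHOLE covariant summand `N_L⊗1 − N_V^Q − N_V^R` live — `sfqrFamily` fixes entry 0 itself, the slot is bookkeeping), slots 1–2 = (R6)'s COVARIANT forward-gradient η-defects in the directions
`μ₁, μ₂`, slot 3 = (R5)'s `(ΔG)`-defect — the three pinned right-hand sides `hE1`∕`hE2`∕`hE3` of (R7b) `ne2PlusOperator_sfqr₄_cov`, letter for letter.
[cite: Balaban1985BackgroundPropagators, Thm 3.1 (3.42) p.397 (the four entries: shape), (3.25)–(3.26) p.395, (3.50)–(3.52) p.400] -/
def sfqrE₄ (hL : Odd L ∧ 1 < L) (a : ℝ) (μ₁ μ₂ : Fin (d + 1)) (i : SfIdx d L) :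
    Fin 4 → (Fin (d + 1) → CvX' d L i.m i.kk i.r hL → Matrix mm mm ℂ) → ((CvX d L i.m i.kk hL × ι → ℝ) →ₗ[ℝ] (CvX' d L i.m i.kk i.r hL × ι → ℝ)) :=
  fun n A' => ![sfqrEntry0 d mm ι a e hL i A',
      idef (pull (liftMap (kingPrV L i.kk i.r (cvM d L i.m i.kk hL)) ι)) (pull (liftMap (kingPrV L i.kk i.r (cvM d L i.m i.kk hL)) ι))
            (covD ((((L ^ i.r * L ^ i.kk : ℕ) : ℝ))⁻¹) (gaugePair (bshiftEquiv (cvM d L i.m i.kk hL) (L ^ i.r * L ^ i.kk)) (fun μ x' => coordMat e (ContinuousLinearMap.mulLeftRight ℝ (Matrix mm mm ℂ) (NormedSpace.exp (((((L ^ i.r * L ^ i.kk : ℕ) : ℝ))⁻¹) • A' μ x')) (NormedSpace.exp (((((L ^ i.r * L ^ i.kk : ℕ) : ℝ))⁻¹) • A' μ x'))ᴴ)) (Sum.inl μ₁)) (bshiftEquiv (cvM d L i.m i.kk hL) (L ^ i.r * L ^ i.kk) μ₁) ∘ₗ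
              cvGlued' d L i.m i.kk i.r hL a ((((L ^ i.r * L ^ i.kk : ℕ) : ℝ))⁻¹) ι e (fun _ _ => (1 : Matrix mm mm ℂ)) (fun μ x' => NormedSpace.exp (((((L ^ i.r * L ^ i.kk : ℕ) : ℝ))⁻¹) • A' μ x')) (cvNL' d L i.m i.kk i.r hL a ι - (cvNVq' d L i.m i.kk i.r hL a ι e (fun μ x' => NormedSpace.exp (((((L ^ i.r * L ^ i.kk : ℕ) : ℝ))⁻¹) • A' μ x'))) - (cvNVr' d L i.m i.kk i.r hL a ι e (fun μ x' => NormedSpace.exp (((((L ^ i.r * L ^ i.kk : ℕ) : ℝ))⁻¹) • A' μ x')))) (fun _ => (cvNVq' d L i.m i.kk i.r hL a ι e (fun μ x' => NormedSpace.exp (((((L ^ i.r * L ^ i.kk : ℕ) : ℝ))⁻¹) • A' μ x'))) + (cvNVr' d L i.m i.kk i.r hL a ι e (fun μ x' => NormedSpace.exp (((((L ^ i.r * L ^ i.kk : ℕ) : ℝ))⁻¹) • A' μ x')))))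
            (covD ((((L ^ i.kk : ℕ) : ℝ))⁻¹) (gaugePair (bshiftEquiv (cvM d L i.m i.kk hL) (L ^ i.kk)) (fun μ x => coordMat e (ContinuousLinearMap.mulLeftRight ℝ (Matrix mm mm ℂ) (NormedSpace.exp (((((L ^ i.kk : ℕ) : ℝ))⁻¹) • gavgM (Matrix mm mm ℂ) (Fin (d + 1)) (kingPrV L i.kk i.r (cvM d L i.m i.kk hL)) A' μ x)) (NormedSpace.exp (((((L ^ i.kk : ℕ) : ℝ))⁻¹) • gavgM (Matrix mm mm ℂ) (Fin (d + 1)) (kingPrV L i.kk i.r (cvM d L i.m i.kk hL)) A' μ x))ᴴ)) (Sum.inl μ₁)) (bshiftEquiv (cvM d L i.m i.kk hL) (L ^ i.kk) μ₁) ∘ₗ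
              cvGlued d L i.m i.kk hL a ((((L ^ i.kk : ℕ) : ℝ))⁻¹) ι e (fun _ _ => (1 : Matrix mm mm ℂ)) (fun μ x => NormedSpace.exp (((((L ^ i.kk : ℕ) : ℝ))⁻¹) • gavgM (Matrix mm mm ℂ) (Fin (d + 1)) (kingPrV L i.kk i.r (cvM d L i.m i.kk hL)) A' μ x)) (cvNL d L i.m i.kk hL a ι - (cvNVq d L i.m i.kk hL a ι e (fun μ x => NormedSpace.exp (((((L ^ i.kk : ℕ) : ℝ))⁻¹) • gavgM (Matrix mm mm ℂ) (Fin (d + 1)) (kingPrV L i.kk i.r (cvM d L i.m i.kk hL)) A' μ x))) - (cvNVr d L i.m i.kk hL a ι e (fun μ x => NormedSpace.exp (((((L ^ i.kk : ℕ) : ℝ))⁻¹) • gavgM (Matrix mm mm ℂ) (Fin (d + 1)) (kingPrV L i.kk i.r (cvM d L i.m i.kk hL)) A' μ x)))) (fun _ => (cvNVq d L i.m i.kk hL a ι e (fun μ x => NormedSpace.exp (((((L ^ i.kk : ℕ) : ℝ))⁻¹) • gavgM (Matrix mm mm ℂ) (Fin (d + 1)) (kingPrV L i.kk i.r (cvM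 d L i.m i.kk hL)) A' μ x))) + (cvNVr d L i.m i.kk hL a ι e (fun μ x => NormedSpace.exp (((((L ^ i.kk : ℕ) : ℝ))⁻¹) • gavgM (Matrix mm mm ℂ) (Fin (d + 1)) (kingPrV L i.kk i.r (cvM d L i.m i.kk hL)) A' μ x))))),
      idef (pull (liftMap (kingPrV L i.kk i.r (cvM d L i.m i.kk hL)) ι)) (pull (liftMap (kingPrV L i.kk i.r (cvM d L i.m i.kk hL)) ι))
            (covD ((((L ^ i.r * L ^ i.kk : ℕ) : ℝ))⁻¹) (gaugePair (bshiftEquiv (cvM d L i.m i.kk hL) (L ^ i.r * L ^ i.kk)) (fun μ x' => coordMat e (ContinuousLinearMap.mulLeftRight ℝ (Matrix mm mm ℂ) (NormedSpace.exp (((((L ^ i.r * L ^ i.kk : ℕ) : ℝ))⁻¹) • A' μ x')) (NormedSpace.exp (((((L ^ i.r * L ^ i.kk : ℕ) : ℝ))⁻¹) • A' μ x'))ᴴ)) (Sum.inl μ₂)) (bshiftEquiv (cvM d L i.m i.kk hL) (L ^ i.r * L ^ i.kk) μ₂) ∘ₗ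
              cvGlued' d L i.m i.kk i.r hL a ((((L ^ i.r * L ^ i.kk : ℕ) : ℝ))⁻¹) ι e (fun _ _ => (1 : Matrix mm mm ℂ)) (fun μ x' => NormedSpace.exp (((((L ^ i.r * L ^ i.kk : ℕ) : ℝ))⁻¹) • A' μ x')) (cvNL' d L i.m i.kk i.r hL a ι - (cvNVq' d L i.m i.kk i.r hL a ι e (fun μ x' => NormedSpace.exp (((((L ^ i.r * L ^ i.kk : ℕ) : ℝ))⁻¹) • A' μ x'))) - (cvNVr' d L i.m i.kk i.r hL a ι e (fun μ x' => NormedSpace.exp (((((L ^ i.r * L ^ i.kk : ℕ) : ℝ))⁻¹) • A' μ x')))) (fun _ => (cvNVq' d L i.m i.kk i.r hL a ι e (fun μ x' => NormedSpace.exp (((((L ^ i.r * L ^ i.kk : ℕ) : ℝ))⁻¹) • A' μ x'))) + (cvNVr' d L i.m i.kk i.r hL a ι e (fun μ x' => NormedSpace.exp (((((L ^ i.r * L ^ i.kk : ℕ) : ℝ))⁻¹) • A' μ x')))))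
            (covD ((((L ^ i.kk : ℕ) : ℝ))⁻¹) (gaugePair (bshiftEquiv (cvM d L i.m i.kk hL) (L ^ i.kk)) (fun μ x => coordMat e (ContinuousLinearMap.mulLeftRight ℝ (Matrix mm mm ℂ) (NormedSpace.exp (((((L ^ i.kk : ℕ) : ℝ))⁻¹) • gavgM (Matrix mm mm ℂ) (Fin (d + 1)) (kingPrV L i.kk i.r (cvM d L i.m i.kk hL)) A' μ x)) (NormedSpace.exp (((((L ^ i.kk : ℕ) : ℝ))⁻¹) • gavgM (Matrix mm mm ℂ) (Fin (d + 1)) (kingPrV L i.kk i.r (cvM d L i.m i.kk hL)) A' μ x))ᴴ)) (Sum.inl μ₂)) (bshiftEquiv (cvM d L i.m i.kk hL) (L ^ i.kk) μ₂) ∘ₗ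
              cvGlued d L i.m i.kk hL a ((((L ^ i.kk : ℕ) : ℝ))⁻¹) ι e (fun _ _ => (1 : Matrix mm mm ℂ)) (fun μ x => NormedSpace.exp (((((L ^ i.kk : ℕ) : ℝ))⁻¹) • gavgM (Matrix mm mm ℂ) (Fin (d + 1)) (kingPrV L i.kk i.r (cvM d L i.m i.kk hL)) A' μ x)) (cvNL d L i.m i.kk hL a ι - (cvNVq d L i.m i.kk hL a ι e (fun μ x => NormedSpace.exp (((((L ^ i.kk : ℕ) : ℝ))⁻¹) • gavgM (Matrix mm mm ℂ) (Fin (d + 1)) (kingPrV L i.kk i.r (cvM d L i.m i.kk hL)) A' μ x))) - (cvNVr d L i.m i.kk hL a ι e (fun μ x => NormedSpace.exp (((((L ^ i.kk : ℕ) : ℝ))⁻¹) • gavgM (Matrix mm mm ℂ) (Fin (d + 1)) (kingPrV L i.kk i.r (cvM d L i.m i.kk hL)) A' μ x)))) (fun _ => (cvNVq d L i.m i.kk hL a ι e (fun μ x => NormedSpace.exp (((((L ^ i.kk : ℕ) : ℝ))⁻¹) • gavgM (Matrix mm mm ℂ) (Fin (d + 1)) (kingPrV L i.kk i.r (cvM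 d L i.m i.kk hL)) A' μ x))) + (cvNVr d L i.m i.kk hL a ι e (fun μ x => NormedSpace.exp (((((L ^ i.kk : ℕ) : ℝ))⁻¹) • gavgM (Matrix mm mm ℂ) (Fin (d + 1)) (kingPrV L i.kk i.r (cvM d L i.m i.kk hL)) A' μ x))))),
      idef (pull (liftMap (kingPrV L i.kk i.r (cvM d L i.m i.kk hL)) ι)) (pull (liftMap (kingPrV L i.kk i.r (cvM d L i.m i.kk hL)) ι)) ((covLapM (bshiftEquiv (cvM d L i.m i.kk hL) (L ^ i.r * L ^ i.kk)) ((((L ^ i.r * L ^ i.kk : ℕ) : ℝ))⁻¹) (gaugePair (bshiftEquiv (cvM d L i.m i.kk hL) (L ^ i.r * L ^ i.kk)) (fun μ x' => coordMat e (ContinuousLinearMap.mulLeftRight ℝ (Matrix mm mm ℂ) (NormedSpace.exp (((((L ^ i.r * L ^ i.kk : ℕ) : ℝ))⁻¹) • A' μ x')) (NormedSpace.exp (((((L ^ i.r * L ^ i.kk : ℕ) : ℝ))⁻¹) • A' μ x'))ᴴ)))) ∘ₗ (cvGlued' d L i.m i.kk i.r hL a ((((L ^ i.r * L ^ i.kk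 : ℕ) : ℝ))⁻¹) ι e (fun _ _ => (1 : Matrix mm mm ℂ)) (fun μ x' => NormedSpace.exp (((((L ^ i.r * L ^ i.kk : ℕ) : ℝ))⁻¹) • A' μ x')) (cvNL' d L i.m i.kk i.r hL a ι - (cvNVq' d L i.m i.kk i.r hL a ι e (fun μ x' => NormedSpace.exp (((((L ^ i.r * L ^ i.kk : ℕ) : ℝ))⁻¹) • A' μ x'))) - (cvNVr' d L i.m i.kk i.r hL a ι e (fun μ x' => NormedSpace.exp (((((L ^ i.r * L ^ i.kk : ℕ) : ℝ))⁻¹) • A' μ x')))) (fun _ => (cvNVq' d L i.m i.kk i.r hL a ι e (fun μ x' => NormedSpace.exp (((((L ^ i.r * L ^ i.kk : ℕ) : ℝ))⁻¹) • A' μ x'))) + (cvNVr' d L i.m i.kk i.r hL a ι e (fun μ x' => NormedSpace.exp (((((L ^ i.r * L ^ i.kk : ℕ) : ℝ))⁻¹) • A' μ x')))))) ((covLapM (bshiftEquiv (cvM d L i.m i.kk hL) (L ^ i.kk)) ((((L ^ i.kk : ℕ) : ℝ))⁻¹) (gaugePair (bshiftEquiv (cvM d L i.m i.kk hL) (L ^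 i.kk)) (fun μ x => coordMat e (ContinuousLinearMap.mulLeftRight ℝ (Matrix mm mm ℂ) (NormedSpace.exp (((((L ^ i.kk : ℕ) : ℝ))⁻¹) • gavgM (Matrix mm mm ℂ) (Fin (d + 1)) (kingPrV L i.kk i.r (cvM d L i.m i.kk hL)) A' μ x)) (NormedSpace.exp (((((L ^ i.kk : ℕ) : ℝ))⁻¹) • gavgM (Matrix mm mm ℂ) (Fin (d + 1)) (kingPrV L i.kk i.r (cvM d L i.m i.kk hL)) A' μ x))ᴴ)))) ∘ₗ (cvGlued d L i.m i.kk hL a ((((L ^ i.kk : ℕ) : ℝ))⁻¹) ι e (fun _ _ => (1 : Matrix mm mm ℂ)) (fun μ x => NormedSpace.exp (((((L ^ i.kk : ℕ) : ℝ))⁻¹) • gavgM (Matrix mm mm ℂ) (Fin (d + 1)) (kingPrV L i.kk i.r (cvM d L i.m i.kk hL)) A' μ x)) (cvNL d L i.m i.kk hL a ι - (cvNVq d L i.m i.kk hL a ι e (fun μ x => NormedSpace.exp (((((L ^ i.kk : ℕ) : ℝ))⁻¹) • gavgM (Matrix mm mm ℂ) (Fin (d + 1)) (kingPrV L i.kk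 i.r (cvM d L i.m i.kk hL)) A' μ x))) - (cvNVr d L i.m i.kk hL a ι e (fun μ x => NormedSpace.exp (((((L ^ i.kk : ℕ) : ℝ))⁻¹) • gavgM (Matrix mm mm ℂ) (Fin (d + 1)) (kingPrV L i.kk i.r (cvM d L i.m i.kk hL)) A' μ x)))) (fun _ => (cvNVq d L i.m i.kk hL a ι e (fun μ x => NormedSpace.exp (((((L ^ i.kk : ℕ) : ℝ))⁻¹) • gavgM (Matrix mm mm ℂ) (Fin (d + 1)) (kingPrV L i.kk i.r (cvM d L i.m i.kk hL)) A' μ x))) + (cvNVr d L i.m i.kk hL a ι e (fun μ x => NormedSpace.exp (((((L ^ i.kk : ℕ) : ℝ))⁻¹) • gavgM (Matrix mm mm ℂ) (Fin (d + 1)) (kingPrV L i.kk i.r (cvM d L i.m i.kk hL)) A' μ x))))))] n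

set_option maxHeartbeats 1600000 in
set_option maxRecDepth 8192 in
/-- ★★★ **`NE2PlusOperator` FOR THE (P-R) FAMILY WITH ALL FOUR ENTRIES CONCRETE, MODULO 207b's THREE THRESHOLDED LANDAU ROWS** — (R7b) `ne2PlusOperator_sfqr₄_cov` fed with `Σ-R = sfqrE₄ … μ₁ μ₂`
(`rfl` ×3): the operator layer of (3.42) with Bałaban's WHOLE covariant summand LIVE in the propagator, ALL FOUR ENTRIES CONSTRUCTED, NO entry row displayed; displayed remains ONLY the Landau
letter's three thresholded global rows `hG` (odd `L ≥ 7`, `a, c₃₅ > 0`, trace-form-orthonormal `e`).  MODEL family; NOT [B9] Thm 3.1∕3.14 as printed.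
[cite: Balaban1985BackgroundPropagators, Thm 3.1 (3.42) p.397 (template: MODEL level), (3.25)–(3.26) p.395, (3.49) p.399; Balaban1985Averaging, (124)–(125) p.36] -/
theorem ne2PlusOperator_sfqr₄E (hL : Odd L ∧ 1 < L) (hL7 : 7 ≤ L) {a : ℝ} (ha : 0 < a) {c35 : ℝ} (hc35 : 0 < c35) (he : ∀ A B : Matrix mm mm ℂ, traceForm A B = e A ⬝ᵥ e B)
    (μ₁ μ₂ : Fin (d + 1))
    (hG : ∃ δR cR CR γR aG : ℝ, 0 < δR ∧ 0 ≤ cR ∧ 0 ≤ CR ∧ 0 < γR ∧ 0 < aG ∧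
      ∀ i : SfIdx d L, ∀ α₀ : ℝ, 0 < α₀ → (L : ℝ) ^ i.m * α₀ ≤ aG → ∀ A' : Fin (d + 1) → CvX' d L i.m i.kk i.r hL → Matrix mm mm ℂ, (sfInstance d mm ι hL i).Bf.Reg335 c35 α₀ A' →
        HasMaj (CvNorm d L i.m i.kk hL ι) (CvNorm d L i.m i.kk hL ι) (cvNVr d L i.m i.kk hL a ι e (fun μ x => NormedSpace.exp (((((L ^ i.kk : ℕ) : ℝ))⁻¹) • gavgM (Matrix mm mm ℂ) (Fin (d + 1)) (kingPrV L i.kk i.r (cvM d L i.m i.kk hL)) A' μ x))) (fun y y' => (cR * (c35 * (L : ℝ) ^ i.m * α₀)) * Real.exp (-(δR * (unitTorusGeo L i.kk (cvM d L i.m i.kk hL)).dist y y'))) ∧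
        HasMaj (BlockNorm.ofBlocks (unitTorusGeo L i.kk (cvM d L i.m i.kk hL)) (liftBlk (cvBlk d L i.m i.kk hL ∘ (kingPrV L i.kk i.r (cvM d L i.m i.kk hL))) ι)) (BlockNorm.ofBlocks (unitTorusGeo L i.kk (cvM d L i.m i.kk hL)) (liftBlk (cvBlk d L i.m i.kk hL ∘ (kingPrV L i.kk i.r (cvM d L i.m i.kk hL))) ι)) (cvNVr' d L i.m i.kk i.r hL a ι e (fun μ x' => NormedSpace.exp (((((L ^ i.r * L ^ i.kk : ℕ) : ℝ))⁻¹) • A' μ x'))) (fun y y' => (cR * (c35 * (L : ℝ) ^ i.m * α₀)) * Real.exp (-(δR * (unitTorusGeo L i.kk (cvM d L i.m i.kk hL)).dist y y'))) ∧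
        HasMaj (CvNorm d L i.m i.kk hL ι) (BlockNorm.ofBlocks (unitTorusGeo L i.kk (cvM d L i.m i.kk hL)) (liftBlk (cvBlk d L i.m i.kk hL ∘ (kingPrV L i.kk i.r (cvM d L i.m i.kk hL))) ι)) (idef (pull (liftMap (kingPrV L i.kk i.r (cvM d L i.m i.kk hL)) ι)) (pull (liftMap (kingPrV L i.kk i.r (cvM d L i.m i.kk hL)) ι)) (cvNVr' d L i.m i.kk i.r hL a ι e (fun μ x' => NormedSpace.exp (((((L ^ i.r * L ^ i.kk : ℕ) : ℝ))⁻¹) • A' μ x'))) (cvNVr d L i.m i.kk hL a ι e (fun μ x => NormedSpace.exp (((((L ^ i.kk : ℕ) : ℝ))⁻¹) • gavgM (Matrix mm mm ℂ) (Fin (d + 1)) (kingPrV L i.kk i.r (cvM d L i.m i.kk hL)) A' μ x)))) (fun y y' => (CR * ((L : ℝ) ^ i.kk) ^ (-γR)) * Real.exp (-(δR * (unitTorusGeo L i.kk (cvM d L i.m i.kk hL)).dist y y')))) :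
    NE2PlusOperator c35 (sfInstance d mm ι hL) (fun i => sfqrFamily d mm ι a e hL i (sfqrE₄ d mm ι e hL a μ₁ μ₂ i)) :=
  ne2PlusOperator_sfqr₄_cov d mm ι e hL hL7 ha hc35 he μ₁ μ₂ (sfqrE₄ d mm ι e hL a μ₁ μ₂) (fun _ _ => rfl) (fun _ _ => rfl) (fun _ _ => rfl) hG

set_option maxRecDepth 8192 in
/-- ★★★ **`NE2PlusOperator` FOR THE (P-R) FAMILY WITH ALL FOUR ENTRIES CONCRETE ON n15-c∕223's DISPLAY — ALL FOUR FLAT ROWS PROVED**: displayed are ONLY, per grid, the ONE covariant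
gradient-difference row `D_TG′(T) − ∂G′(1)` (`hP`, [B9] Thm 3.4's Schauder-type row) and the two-grid η-defect row of `N_V^R` (`hD`) — `ne2PlusOperator_sfqr₄E` ∘ (♭-6)
`landauRows_small_of_gradDiffRow` (King's three flat kernel rows n15-c∕220, the Combes–Thomas `S⁻¹` row n15-c∕222b).  MODEL family; NOT [B9] Thms 3.1–3.4 ∕ 3.14 as printed.
[cite: Balaban1985BackgroundPropagators, Thm 3.1 (3.42) p.397, (3.49) p.399, Thm 3.4 p.400 (templates: MODEL level); Balaban1983RegularityDecay, Theorem (1.10) p.573; King1986, Thm 3.3 p.656] -/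
theorem ne2PlusOperator_sfqr₄E_of_gradDiffRow (hL : Odd L ∧ 1 < L) (hL7 : 7 ≤ L) {a : ℝ} (ha : 0 < a) {c35 : ℝ} (hc35 : 0 < c35) (he : ∀ A B : Matrix mm mm ℂ, traceForm A B = e A ⬝ᵥ e B)
    (μ₁ μ₂ : Fin (d + 1))
    (hP : ∃ δ₂ P0 aP : ℝ, 0 < δ₂ ∧ 0 ≤ P0 ∧ 0 < aP ∧ ∀ i : SfIdx d L,
        ∀ α₀ : ℝ, 0 < α₀ → (L : ℝ) ^ i.m * α₀ ≤ aP → ∀ A' : Fin (d + 1) → CvX' d L i.m i.kk i.r hL → Matrix mm mm ℂ, (sfInstance d mm ι hL i).Bf.Reg335 c35 α₀ A' →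
          HasMaj (BlockNorm.ofBlocks (unitTorusGeo L i.kk (cvM d L i.m i.kk hL)) (liftBlk (blockOf (L ^ i.kk) (cvM d L i.m i.kk hL)) ι)) (BlockNorm.ofBlocks (unitTorusGeo L i.kk (cvM d L i.m i.kk hL)) (liftBlk (fun b : Tor (fine (L ^ i.kk) (cvM d L i.m i.kk hL)) × Fin (d + 1) => blockOf (L ^ i.kk) (cvM d L i.m i.kk hL) b.1) ι)) (Matrix.mulVecLin (cgrad (cvM d L i.m i.kk hL) (L ^ i.kk) (cvT₀ e (fun μ x => NormedSpace.exp (((((L ^ i.kk : ℕ) : ℝ))⁻¹) • gavgM (Matrix mm mm ℂ) (Fin (d + 1)) (kingPrV L i.kk i.r (cvM d L i.m i.kk hL)) A' μ x))) * cGreen (cvM d L i.m i.kk hL) (L ^ i.kk) (cvT₀ e (fun μ x => NormedSpace.exp (((((L ^ i.kk : ℕ) : ℝ))⁻¹) • gavgM (Matrix mm mm ℂ) (Fin (d + 1)) (kingPrV L i.kk i.r (cvM d L i.m i.kk hL)) A' μ x))) (aK 1 (L : ℝ) i.kk * ((L ^ i.kk : ℕ) : ℝ) ^ (d + 1)) -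 cgrad (cvM d L i.m i.kk hL) (L ^ i.kk) (fun (_ : Fin (d + 1)) (_ : Tor (fine (L ^ i.kk) (cvM d L i.m i.kk hL))) => (1 : Matrix ι ι ℝ)) * cGreen (cvM d L i.m i.kk hL) (L ^ i.kk) (fun (_ : Fin (d + 1)) (_ : Tor (fine (L ^ i.kk) (cvM d L i.m i.kk hL))) => (1 : Matrix ι ι ℝ)) (aK 1 (L : ℝ) i.kk * ((L ^ i.kk : ℕ) : ℝ) ^ (d + 1)))) (fun y y' => P0 * (c35 * (L : ℝ) ^ i.m * α₀) * Real.exp (-(δ₂ * (unitTorusGeo L i.kk (cvM d L i.m i.kk hL)).dist y y'))) ∧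
          HasMaj (BlockNorm.ofBlocks (unitTorusGeo L i.kk (cvM d L i.m i.kk hL)) (liftBlk (blockOf (L ^ i.r * L ^ i.kk) (cvM d L i.m i.kk hL)) ι)) (BlockNorm.ofBlocks (unitTorusGeo L i.kk (cvM d L i.m i.kk hL)) (liftBlk (fun b : Tor (fine (L ^ i.r * L ^ i.kk) (cvM d L i.m i.kk hL)) × Fin (d + 1) => blockOf (L ^ i.r * L ^ i.kk) (cvM d L i.m i.kk hL) b.1) ι)) (Matrix.mulVecLin (cgrad (cvM d L i.m i.kk hL) (L ^ i.r * L ^ i.kk) (cvT₀ e (fun μ x' => NormedSpace.exp (((((L ^ i.r * L ^ i.kk : ℕ) : ℝ))⁻¹) • A' μ x'))) * cGreen (cvM d L i.m i.kk hL) (L ^ i.r * L ^ i.kk) (cvT₀ e (fun μ x' => NormedSpace.exp (((((L ^ i.r * L ^ i.kk : ℕ) : ℝ))⁻¹) • A' μ x'))) (aK 1 (L : ℝ) (i.r + i.kk) * ((L ^ i.r * L ^ i.kk : ℕ) : ℝ) ^ (d + 1)) - cgrad (cvM d L i.m i.kk hL) (L ^ i.r * L ^ i.kk) (fun (_ : Fin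 (d + 1)) (_ : Tor (fine (L ^ i.r * L ^ i.kk) (cvM d L i.m i.kk hL))) => (1 : Matrix ι ι ℝ)) * cGreen (cvM d L i.m i.kk hL) (L ^ i.r * L ^ i.kk) (fun (_ : Fin (d + 1)) (_ : Tor (fine (L ^ i.r * L ^ i.kk) (cvM d L i.m i.kk hL))) => (1 : Matrix ι ι ℝ)) (aK 1 (L : ℝ) (i.r + i.kk) * ((L ^ i.r * L ^ i.kk : ℕ) : ℝ) ^ (d + 1)))) (fun y y' => P0 * (c35 * (L : ℝ) ^ i.m * α₀) * Real.exp (-(δ₂ * (unitTorusGeo L i.kk (cvM d L i.m i.kk hL)).dist y y'))))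
    (hD : ∃ δD CR γR aD : ℝ, 0 < δD ∧ 0 ≤ CR ∧ 0 < γR ∧ 0 < aD ∧
      ∀ i : SfIdx d L, ∀ α₀ : ℝ, 0 < α₀ → (L : ℝ) ^ i.m * α₀ ≤ aD → ∀ A' : Fin (d + 1) → CvX' d L i.m i.kk i.r hL → Matrix mm mm ℂ, (sfInstance d mm ι hL i).Bf.Reg335 c35 α₀ A' →
        HasMaj (CvNorm d L i.m i.kk hL ι) (BlockNorm.ofBlocks (unitTorusGeo L i.kk (cvM d L i.m i.kk hL)) (liftBlk (cvBlk d L i.m i.kk hL ∘ (kingPrV L i.kk i.r (cvM d L i.m i.kk hL))) ι)) (idef (pull (liftMap (kingPrV L i.kk i.r (cvM d L i.m i.kk hL)) ι)) (pull (liftMap (kingPrV L i.kk i.r (cvM d L i.m i.kk hL)) ι)) (cvNVr' d L i.m i.kk i.r hL a ι e (fun μ x' => NormedSpace.exp (((((L ^ i.r * L ^ i.kk : ℕ) : ℝ))⁻¹) • A' μ x'))) (cvNVr d L i.m i.kk hL a ι e (fun μ x => NormedSpace.exp (((((L ^ i.kk : ℕ) : ℝ))⁻¹) • gavgM (Matrix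 mm mm ℂ) (Fin (d + 1)) (kingPrV L i.kk i.r (cvM d L i.m i.kk hL)) A' μ x)))) (fun y y' => (CR * ((L : ℝ) ^ i.kk) ^ (-γR)) * Real.exp (-(δD * (unitTorusGeo L i.kk (cvM d L i.m i.kk hL)).dist y y')))) :
    NE2PlusOperator c35 (sfInstance d mm ι hL) (fun i => sfqrFamily d mm ι a e hL i (sfqrE₄ d mm ι e hL a μ₁ μ₂ i)) :=
  ne2PlusOperator_sfqr₄E d mm ι e hL hL7 ha hc35 he μ₁ μ₂ (landauRows_small_of_gradDiffRow d mm ι e hL hL7 ha hc35 hP hD)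

end Node

end Summit.QuantumFields.YangMills.BalabanUVNodes.N15.Gluing

end
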